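import Literature.MathematicalPhysics.QuantumLattice.HubbardChemicalPotentialTL
import Literature.MathematicalPhysics.QuantumLattice.HubbardNNNHoppingEnergyDensityRegionBounds
import HarnessLib

/-!
# Certified energy words across a FILLING BOX `n ∈ [n₁, n₂]` of the 2D `t–t'` Hubbard model:
# box caps, box floors, particle–hole image

Topic `MathematicalPhysics/QuantumLattice` (family `hubbard`); namespace
`Literature.MathematicalPhysics.QuantumLattice.ThermodynamicLimit`. Written for the material-oracle
pipeline (downfolding front end ↦ certifier): a downfolded material arrives with a FILLING INTERVAL
`n ∈ [n₁, n₂]` (doping content, self-doping and stoichiometry are only known to a box), while certified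
rows are produced at POINT densities. The energy density `e(n) = energyDensityTT' t t' U n` of the
square-lattice Hubbard model with nearest (`t`) and next-nearest (`t'`) neighbour hopping is CONVEX in the
density on `[0, 2)` for `U ≥ 0` (`convexOn_energyDensityTT'`; Ruelle 1969 §3.3–§3.4, Lieb–Wu 2003 §7), and
every statement below is a by-name consequence of that convexity, shaped so that a box engine evaluates
finitely many ENDPOINT expressions and owns a bound on the whole CLOSED box (companion file
`HubbardFillingBoxChemicalPotentialCell.lean`: the chemical-potential cell of a box and the slope sandwich):

* §1 CAPS over a closed box: certified caps `e(m₁) ≤ u₁`, `e(m₂) ≤ u₂` at densities `m₁ ≤ n₁`, `n₂ ≤ m₂`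
  bracketing the box give `e(n) ≤ chord ≤ max u₁ u₂` for every `n ∈ [m₁, m₂]`
  (`energyDensityTT'_le_density_chord_of_mem_Icc`, `energyDensityTT'_le_max_of_mem_Icc`,
  `energyDensityTT'_le_max_zero_of_mem_Icc`; the open-interval chord is the tree's
  `energyDensityTT'_le_density_chord`).
* §2 FLOORS over a closed box: a cap at `n₀ < n₁` and a floor at `n₁` give, on `[n₁, n₂]`, the secant
  extension of the tree's `energyDensityTT'_ge_density_extrapolate_right`, whose minimum over the box is
  the `min` of its two endpoint values (`energyDensityTT'_ge_min_of_mem_Icc_right`; mirror image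
  `energyDensityTT'_ge_min_of_mem_Icc_left` from a floor at `n₂` and a cap at `n₃ > n₂`; both:
  `energyDensityTT'_ge_max_min_of_mem_Icc`); a supporting line (e.g. a grand-canonical energy certificate
  `ℓ + s (x - c) ≤ e(x)` on `[0, 2)`, or `energyDensityTT'_add_mul_le_of_mem_Icc`) floors the box by the
  `min` of its endpoint values (`energyDensityTT'_ge_min_of_supportingLine`).
* §3 PARTICLE–HOLE IMAGE of a box on the electron-doped side (`n > 1`): an electron-doped box
  `[n₁, n₂] ⊂ (1, 2)` is the hole-doped box `[2 - n₂, 2 - n₁]` at `-t'`; pointwise identities for `e` (the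
  tree's `energyDensityTT'_particleHole`) and for `μ±` (`chemPotPlusTT'_eq_sub_particleHole`,
  `chemPotMinusTT'_eq_sub_particleHole`), cap/floor transport forms
  (`energyDensityTT'_le_of_particleHole_le`, `le_energyDensityTT'_of_le_particleHole`).

HONEST LIMITS. Convexity gives NO floor strictly inside a box from endpoint floors alone (§2 needs a cap
OUTSIDE the box, or a slope), and no cap outside the bracketing caps; no number is computed here. The
words transported are ENERGY words; correlator words ride on the energy cap through the tree's
window-certificate theorems, whose density dependence is affine (the term `(Σσ μσ)(n/2 - ν)` of
`InfVolFermionState.IsTorusLimitOf.re_expect_ge_of_window_certificate_TT'_ineq_of_slack`), so over a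
box they are again decided at the two endpoints, with the box cap of §1 in the slack. Everything is
PROVED; no definition, no named fact, no sorry.

## Tree search (cited, not restated)

`convexOn_energyDensityTT'`, `energyDensityTT'_le_density_chord`, `energyDensityTT'_le_vacuum_chord`,
`energyDensityTT'_density_zero_le`, `energyDensityTT'_ge_density_extrapolate_right/left`,
`energyDensityTT'_particleHole`, `chemPotPlusTT'_add_chemPotMinusTT'_two_sub`.

## References

* D. Ruelle, *Statistical Mechanics: Rigorous Results* (1969), §3.3–§3.4 (convexity of the energy
  density in the density; supporting lines = chemical potentials). [cite: Ruelle1969, §3.3]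
* E. H. Lieb, F. Y. Wu, Physica A 321 (2003) 1–27, §7 (convexity of `e`; `μ₊ + μ₋ = U` under the
  hole–particle map). [cite: LiebWuPhysicaA2003, §7]
-/

noncomputable section

namespace Literature.MathematicalPhysics.QuantumLattice

namespace ThermodynamicLimit

open Set

/-! ### §0 Affine functions on a closed interval -/

/-- An affine function on `[x₁, x₂]` is at least the smaller of its endpoint values. [folklore] -/
private theorem min_affine_le_of_mem_Icc (a b : ℝ) {x₁ x₂ x : ℝ} (hx : x ∈ Icc x₁ x₂) :
    min (a + b * x₁) (a + b * x₂) ≤ a + b * x := by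
  rcases le_total 0 b with hb | hb
  · exact (min_le_left _ _).trans (by nlinarith [hx.1])
  · exact (min_le_right _ _).trans (by nlinarith [hx.2])

/-! ### §1 Caps over a closed filling box -/

/-- **Density chord on the CLOSED box.** For `0 ≤ m₁ < m₂ < 2`, `U ≥ 0`, caps `e(m₁) ≤ u₁`,
`e(m₂) ≤ u₂` and every `n ∈ [m₁, m₂]`: `e(n) ≤ ((m₂ - n) u₁ + (n - m₁) u₂)/(m₂ - m₁)` (endpoints
included; the open-interval case is `energyDensityTT'_le_density_chord`). [cite: Ruelle1969, §3.3] -/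
theorem energyDensityTT'_le_density_chord_of_mem_Icc (t t' : ℝ) {U : ℝ} (hU : 0 ≤ U)
    {m₁ m₂ u₁ u₂ : ℝ} (hm₁ : 0 ≤ m₁) (hm : m₁ < m₂) (hm₂ : m₂ < 2)
    (hu₁ : energyDensityTT' t t' U m₁ ≤ u₁) (hu₂ : energyDensityTT' t t' U m₂ ≤ u₂)
    {n : ℝ} (hn : n ∈ Icc m₁ m₂) :
    energyDensityTT' t t' U n ≤ ((m₂ - n) * u₁ + (n - m₁) * u₂) / (m₂ - m₁) := by
  have hd : 0 < m₂ - m₁ := sub_pos.2 hm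
  rcases eq_or_lt_of_le hn.1 with h₁ | h₁
  · subst h₁
    rw [le_div_iff₀ hd]
    nlinarith [hu₁]
  rcases eq_or_lt_of_le hn.2 with h₂ | h₂
  · subst h₂
    rw [le_div_iff₀ hd]
    nlinarith [hu₂]
  exact energyDensityTT'_le_density_chord t t' hU hm₁ h₁ h₂ hm₂ hu₁ hu₂

/-- **Box CAP = the larger bracketing cap.** For `0 ≤ m₁ ≤ m₂ < 2`, `U ≥ 0`, caps `e(m₁) ≤ u₁`,
`e(m₂) ≤ u₂`: `e(n) ≤ max u₁ u₂` for every `n ∈ [m₁, m₂]` — a filling box `[n₁, n₂] ⊆ [m₁, m₂]`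
bracketed by two certified caps carries the cap `max u₁ u₂`. [cite: Ruelle1969, §3.3] -/
theorem energyDensityTT'_le_max_of_mem_Icc (t t' : ℝ) {U : ℝ} (hU : 0 ≤ U)
    {m₁ m₂ u₁ u₂ : ℝ} (hm₁ : 0 ≤ m₁) (hm₂ : m₂ < 2)
    (hu₁ : energyDensityTT' t t' U m₁ ≤ u₁) (hu₂ : energyDensityTT' t t' U m₂ ≤ u₂)
    {n : ℝ} (hn : n ∈ Icc m₁ m₂) :
    energyDensityTT' t t' U n ≤ max u₁ u₂ := by
  rcases eq_or_lt_of_le (hn.1.trans hn.2) with hm | hm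
  · -- degenerate box `m₁ = m₂ = n`
    have h : n = m₁ := le_antisymm (hm ▸ hn.2) hn.1
    rw [h]
    exact hu₁.trans (le_max_left _ _)
  have hd : 0 < m₂ - m₁ := sub_pos.2 hm
  refine (energyDensityTT'_le_density_chord_of_mem_Icc t t' hU hm₁ hm hm₂ hu₁ hu₂ hn).trans ?_
  rw [div_le_iff₀ hd]
  have h1 : (m₂ - n) * u₁ ≤ (m₂ - n) * max u₁ u₂ :=
    mul_le_mul_of_nonneg_left (le_max_left _ _) (sub_nonneg.2 hn.2)
  have h2 : (n - m₁) * u₂ ≤ (n - m₁) * max u₁ u₂ :=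
    mul_le_mul_of_nonneg_left (le_max_right _ _) (sub_nonneg.2 hn.1)
  nlinarith [h1, h2]

/-- **Box CAP from one cap and the vacuum** (`e(0) ≤ 0`): a cap `e(m₂) ≤ u₂` at `0 < m₂ < 2` gives
`e(n) ≤ max 0 u₂` for every `n ∈ [0, m₂]` (`U ≥ 0`). [cite: Ruelle1969, §3.3] -/
theorem energyDensityTT'_le_max_zero_of_mem_Icc (t t' : ℝ) {U : ℝ} (hU : 0 ≤ U)
    {m₂ u₂ : ℝ} (hm₂ : m₂ < 2) (hu₂ : energyDensityTT' t t' U m₂ ≤ u₂)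
    {n : ℝ} (hn : n ∈ Icc 0 m₂) :
    energyDensityTT' t t' U n ≤ max 0 u₂ :=
  energyDensityTT'_le_max_of_mem_Icc t t' hU le_rfl hm₂ (energyDensityTT'_density_zero_le t t' hU) hu₂ hn

/-! ### §2 Floors over a closed filling box -/

/-- **Box FLOOR from a cap on the LEFT of the box.** For `0 ≤ n₀ < n₁ ≤ n₂ < 2`, `U ≥ 0`, a cap
`e(n₀) ≤ R₀` and a floor `L₁ ≤ e(n₁)`: every `n ∈ [n₁, n₂]` has
`min L₁ (L₁ + (L₁ - R₀)(n₂ - n₁)/(n₁ - n₀)) ≤ e(n)` — the secant through `n₀, n₁` extended over the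
box (`energyDensityTT'_ge_density_extrapolate_right`) is affine, so its minimum over the box is an
endpoint value. [cite: Ruelle1969, §3.3] -/
theorem energyDensityTT'_ge_min_of_mem_Icc_right (t t' : ℝ) {U : ℝ} (hU : 0 ≤ U)
    {n₀ n₁ n₂ R₀ L₁ : ℝ} (hn₀ : 0 ≤ n₀) (h₀₁ : n₀ < n₁) (hn₂ : n₂ < 2)
    (hR₀ : energyDensityTT' t t' U n₀ ≤ R₀) (hL₁ : L₁ ≤ energyDensityTT' t t' U n₁)
    {n : ℝ} (hn : n ∈ Icc n₁ n₂) :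
    min L₁ (L₁ + (L₁ - R₀) * (n₂ - n₁) / (n₁ - n₀)) ≤ energyDensityTT' t t' U n := by
  rcases eq_or_lt_of_le hn.1 with h₁ | h₁
  · subst h₁
    exact (min_le_left _ _).trans hL₁
  have hext := energyDensityTT'_ge_density_extrapolate_right t t' hU hn₀ h₀₁ h₁ (lt_of_le_of_lt hn.2 hn₂)
    hR₀ hL₁
  refine le_trans ?_ hext
  have hd : 0 < n₁ - n₀ := sub_pos.2 h₀₁
  have e1 : L₁ + (L₁ - R₀) * (n₂ - n₁) / (n₁ - n₀) = (L₁ - (L₁ - R₀) / (n₁ - n₀) * n₁) +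
      (L₁ - R₀) / (n₁ - n₀) * n₂ := by
    field_simp
    ring
  have e2 : L₁ + (L₁ - R₀) * (n - n₁) / (n₁ - n₀) = (L₁ - (L₁ - R₀) / (n₁ - n₀) * n₁) +
      (L₁ - R₀) / (n₁ - n₀) * n := by
    field_simp
    ring
  have e0 : L₁ = (L₁ - (L₁ - R₀) / (n₁ - n₀) * n₁) + (L₁ - R₀) / (n₁ - n₀) * n₁ := by ring
  have h := min_affine_le_of_mem_Icc (L₁ - (L₁ - R₀) / (n₁ - n₀) * n₁) ((L₁ - R₀) / (n₁ - n₀)) hn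
  rw [← e0, ← e1, ← e2] at h
  exact h

/-- **Box FLOOR from a cap on the RIGHT of the box.** For `0 ≤ n₁ ≤ n₂ < n₃ < 2`, `U ≥ 0`, a floor
`L₂ ≤ e(n₂)` and a cap `e(n₃) ≤ R₃`: every `n ∈ [n₁, n₂]` has
`min L₂ (L₂ + (L₂ - R₃)(n₂ - n₁)/(n₃ - n₂)) ≤ e(n)` (`energyDensityTT'_ge_density_extrapolate_left`
over the box). [cite: Ruelle1969, §3.3] -/
theorem energyDensityTT'_ge_min_of_mem_Icc_left (t t' : ℝ) {U : ℝ} (hU : 0 ≤ U)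
    {n₁ n₂ n₃ L₂ R₃ : ℝ} (hn₁ : 0 ≤ n₁) (h₂₃ : n₂ < n₃) (hn₃ : n₃ < 2)
    (hL₂ : L₂ ≤ energyDensityTT' t t' U n₂) (hR₃ : energyDensityTT' t t' U n₃ ≤ R₃)
    {n : ℝ} (hn : n ∈ Icc n₁ n₂) :
    min L₂ (L₂ + (L₂ - R₃) * (n₂ - n₁) / (n₃ - n₂)) ≤ energyDensityTT' t t' U n := by
  rcases eq_or_lt_of_le hn.2 with h₂ | h₂
  · subst h₂
    exact (min_le_left _ _).trans hL₂
  have hext := energyDensityTT'_ge_density_extrapolate_left t t' hU (hn₁.trans hn.1) h₂ h₂₃ hn₃ hR₃ hL₂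
  refine le_trans ?_ hext
  have hd : 0 < n₃ - n₂ := sub_pos.2 h₂₃
  -- the extended secant `x ↦ L₂ + (L₂ - R₃)(n₂ - x)/(n₃ - n₂)` is affine with slope `-(L₂ - R₃)/(n₃ - n₂)`
  have e1 : L₂ + (L₂ - R₃) * (n₂ - n₁) / (n₃ - n₂) = (L₂ + (L₂ - R₃) / (n₃ - n₂) * n₂) +
      (-((L₂ - R₃) / (n₃ - n₂))) * n₁ := by
    field_simp
    ring
  have e2 : L₂ + (L₂ - R₃) * (n₂ - n) / (n₃ - n₂) = (L₂ + (L₂ - R₃) / (n₃ - n₂) * n₂) +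
      (-((L₂ - R₃) / (n₃ - n₂))) * n := by
    field_simp
    ring
  have e0 : L₂ = (L₂ + (L₂ - R₃) / (n₃ - n₂) * n₂) + (-((L₂ - R₃) / (n₃ - n₂))) * n₂ := by ring
  have h := min_affine_le_of_mem_Icc (L₂ + (L₂ - R₃) / (n₃ - n₂) * n₂) (-((L₂ - R₃) / (n₃ - n₂))) hn
  rw [← e0, ← e1, ← e2, min_comm] at h
  exact h

/-- **Box FLOOR from caps on BOTH sides**: the two one-sided floors combine by `max`.
[cite: Ruelle1969, §3.3] -/
theorem energyDensityTT'_ge_max_min_of_mem_Icc (t t' : ℝ) {U : ℝ} (hU : 0 ≤ U)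
    {n₀ n₁ n₂ n₃ R₀ L₁ L₂ R₃ : ℝ} (hn₀ : 0 ≤ n₀) (h₀₁ : n₀ < n₁) (h₂₃ : n₂ < n₃)
    (hn₃ : n₃ < 2) (hR₀ : energyDensityTT' t t' U n₀ ≤ R₀) (hL₁ : L₁ ≤ energyDensityTT' t t' U n₁)
    (hL₂ : L₂ ≤ energyDensityTT' t t' U n₂) (hR₃ : energyDensityTT' t t' U n₃ ≤ R₃)
    {n : ℝ} (hn : n ∈ Icc n₁ n₂) :
    max (min L₁ (L₁ + (L₁ - R₀) * (n₂ - n₁) / (n₁ - n₀)))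
        (min L₂ (L₂ + (L₂ - R₃) * (n₂ - n₁) / (n₃ - n₂))) ≤ energyDensityTT' t t' U n :=
  max_le
    (energyDensityTT'_ge_min_of_mem_Icc_right t t' hU hn₀ h₀₁ (h₂₃.trans hn₃) hR₀ hL₁ hn)
    (energyDensityTT'_ge_min_of_mem_Icc_left t t' hU (hn₀.trans h₀₁.le) h₂₃ hn₃ hL₂ hR₃ hn)

/-- **Box FLOOR from a SUPPORTING LINE.** If `ℓ + s (x - c) ≤ e(x)` for every `x ∈ [0, 2)` (a
supporting line: e.g. a grand-canonical energy certificate with density multiplier `s` and density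
slot `c`, or `energyDensityTT'_add_mul_le_of_mem_Icc` with `s ∈ [μ₋(c), μ₊(c)]`), then every `n` of a
box `[n₁, n₂] ⊂ [0, 2)` has `min (ℓ + s (n₁ - c)) (ℓ + s (n₂ - c)) ≤ e(n)`. [cite: Ruelle1969, §3.4] -/
theorem energyDensityTT'_ge_min_of_supportingLine (t t' U : ℝ) {ℓ s c n₁ n₂ : ℝ} (hn₁ : 0 ≤ n₁)
    (hn₂ : n₂ < 2) (hline : ∀ x ∈ Ico (0 : ℝ) 2, ℓ + s * (x - c) ≤ energyDensityTT' t t' U x)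
    {n : ℝ} (hn : n ∈ Icc n₁ n₂) :
    min (ℓ + s * (n₁ - c)) (ℓ + s * (n₂ - c)) ≤ energyDensityTT' t t' U n := by
  refine le_trans ?_ (hline n ⟨hn₁.trans hn.1, lt_of_le_of_lt hn.2 hn₂⟩)
  have h := min_affine_le_of_mem_Icc (ℓ - s * c) s hn
  have e1 : ℓ - s * c + s * n₁ = ℓ + s * (n₁ - c) := by ring
  have e2 : ℓ - s * c + s * n₂ = ℓ + s * (n₂ - c) := by ring
  have e3 : ℓ - s * c + s * n = ℓ + s * (n - c) := by ring
  rwa [e1, e2, e3] at h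

/-! ### §3 Particle–hole image of a filling box (electron-doped side) -/

/-- **`μ₊` through the particle–hole map**: `μ₊(t, t', U, n) = U - μ₋(t, -t', U, 2 - n)`
(`0 < n < 2`, `U ≥ 0`; `chemPotPlusTT'_add_chemPotMinusTT'_two_sub` rearranged).
[cite: LiebWuPhysicaA2003, §7] -/
theorem chemPotPlusTT'_eq_sub_particleHole (t t' : ℝ) {U : ℝ} (hU : 0 ≤ U) {n : ℝ} (hn0 : 0 < n)
    (hn2 : n < 2) :
    chemPotPlusTT' t t' U n = U - chemPotMinusTT' t (-t') U (2 - n) := by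
  have h := chemPotPlusTT'_add_chemPotMinusTT'_two_sub t t' hU hn0 hn2
  linarith

/-- **`μ₋` through the particle–hole map**: `μ₋(t, t', U, n) = U - μ₊(t, -t', U, 2 - n)`
(`0 < n < 2`, `U ≥ 0`). [cite: LiebWuPhysicaA2003, §7] -/
theorem chemPotMinusTT'_eq_sub_particleHole (t t' : ℝ) {U : ℝ} (hU : 0 ≤ U) {n : ℝ} (hn0 : 0 < n)
    (hn2 : n < 2) :
    chemPotMinusTT' t t' U n = U - chemPotPlusTT' t (-t') U (2 - n) := by
  have h := chemPotPlusTT'_add_chemPotMinusTT'_two_sub t (-t') hU (n := 2 - n) (by linarith) (by linarith)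
  rw [neg_neg, show (2 : ℝ) - (2 - n) = n by ring] at h
  linarith

/-- **Cap transport through the particle–hole map**: a cap `e(t, -t', U, 2 - n) ≤ h` on the image
density gives `e(t, t', U, n) ≤ h + U (n - 1)` (`0 < n < 2`, `U ≥ 0`). [cite: LiebWuPhysicaA2003, §7] -/
theorem energyDensityTT'_le_of_particleHole_le (t t' : ℝ) {U : ℝ} (hU : 0 ≤ U) {n h : ℝ}
    (hn0 : 0 < n) (hn2 : n < 2) (hcap : energyDensityTT' t (-t') U (2 - n) ≤ h) :
    energyDensityTT' t t' U n ≤ h + U * (n - 1) := by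
  rw [energyDensityTT'_particleHole t t' hU hn0 hn2]
  linarith

/-- **Floor transport through the particle–hole map**: a floor `ℓ ≤ e(t, -t', U, 2 - n)` on the image
density gives `ℓ + U (n - 1) ≤ e(t, t', U, n)` (`0 < n < 2`, `U ≥ 0`). [cite: LiebWuPhysicaA2003, §7] -/
theorem le_energyDensityTT'_of_le_particleHole (t t' : ℝ) {U : ℝ} (hU : 0 ≤ U) {n ℓ : ℝ}
    (hn0 : 0 < n) (hn2 : n < 2) (hfloor : ℓ ≤ energyDensityTT' t (-t') U (2 - n)) :
    ℓ + U * (n - 1) ≤ energyDensityTT' t t' U n := by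
  rw [energyDensityTT'_particleHole t t' hU hn0 hn2]
  linarith

end ThermodynamicLimit

end Literature.MathematicalPhysics.QuantumLattice

end
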